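import Literature.Topology.FourManifolds.ComplexProjectiveSpaceProofs
import Literature.AlgebraicTopology.Homotopy.SphereMapsHomotopyGroups
import Literature.AlgebraicTopology.SingularHomology.HOneProducts
import Literature.AlgebraicTopology.SingularHomology.SingularChains

/-!
# A null-homotopic `ℂℙ¹` induces zero on `H₂`
(helper of line `cross-cap-laurent`, crux `GromovRecognitionRelEnd`, item stmt-SmoothPoincare4-11009;
piece of `helper_noJSpheres`)

If `π₂(M, x) = 0` for every `x` and `M` is path connected, then every continuous map
`F : ℂℙ¹ → M` from the tree's complex projective line induces the zero map on `H₂(·; ℝ)`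
(degree written `2 * 1`, the key of the manifold structure of `ComplexProjectiveSpace 1`).

Proof: transport `F` along the tree's diffeomorphism `ℂℙ¹ ≅ S²`
(`nonempty_diffeomorph_complexProjectiveSpace_one_sphere_holds`) to a map `f : S² → M`; by
`homotopic_const_of_sphere_of_subsingleton_homotopyGroup` (Hatcher, *Algebraic Topology*, §4.1
p. 346, (3) ⇒ (1)) `f` is homotopic to a constant, so `f_* = const_* = 0` on `H₂` (homotopy
invariance, Hatcher Thm. 2.10, and a constant factors through a point, Prop. 2.8); finally
`F = f ∘ d`, so `F_* = f_* ∘ d_* = 0`.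
-/

noncomputable section

-- the prescribed namespace `Summit.<P>.<Sub>.…` duplicates `SmoothPoincare4` (P = Sub)
set_option linter.dupNamespace false

open scoped Manifold ContDiff Topology
open CategoryTheory Module
open Literature.Topology.FourManifolds Literature.AlgebraicTopology.SingularHomology
open Literature.AlgebraicTopology.Homotopy

namespace Summit.SmoothPoincare4.SmoothPoincare4.Theorems.GromovRecognitionRelEnd.CrossCapLaurent

/-- **A null-homotopic `ℂℙ¹` induces zero on `H₂`**: if `π₂(M, x) = 0` for all `x` and `M` is
path connected, every continuous `F : ℂℙ¹ → M` induces `0` on `H₂(·; ℝ)` (`ℂℙ¹ ≅ S²`, sphere maps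
into a space with `π₂ = 0` are null-homotopic, homotopy invariance of singular homology, and a
constant map factors through a point). [cite: HatcherAT2002, §4.1 p. 346 and Thm. 2.10] -/
theorem helper_projectiveLineNullHomology : ∀ (M : Type) [TopologicalSpace M] [PathConnectedSpace M] (F : C(Literature.Topology.FourManifolds.ComplexProjectiveSpace 1, M)), (∀ x : M, Subsingleton (π_ 2 M x)) → Literature.AlgebraicTopology.SingularHomology.singularHomology.map ℝ ℝ F (2 * 1) = 0 := by
  intro M _ _ F hπ
  -- `ℂℙ¹ ≅ S²` (the tree's diffeomorphism, as a homeomorphism)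
  let d : ComplexProjectiveSpace 1 ≃ₜ Metric.sphere (0 : EuclideanSpace ℝ (Fin (2 + 1))) 1 :=
    (Classical.choice nonempty_diffeomorph_complexProjectiveSpace_one_sphere_holds).toHomeomorph
  obtain ⟨p₀⟩ := (inferInstance : Nonempty (ComplexProjectiveSpace 1))
  -- `F` read on the sphere is null-homotopic
  set f : C(Metric.sphere (0 : EuclideanSpace ℝ (Fin (2 + 1))) 1, M) :=
    F.comp (d.symm : C(Metric.sphere (0 : EuclideanSpace ℝ (Fin (2 + 1))) 1, ComplexProjectiveSpace 1))
    with hf_def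
  have hf : f.Homotopic (ContinuousMap.const _ (F p₀)) :=
    homotopic_const_of_sphere_of_subsingleton_homotopyGroup (m := 2) finrank_euclideanSpace_fin
      (fun _ => hπ) f (F p₀)
  have h0 : singularHomology.map ℝ ℝ f (2 * 1) = 0 := by
    rw [singularHomology.map_eq_of_homotopic ℝ ℝ hf]
    exact singularHomology.map_const ℝ ℝ (F p₀) (by norm_num)
  -- `F = f ∘ d`
  have hF : F = f.comp (d : C(ComplexProjectiveSpace 1, Metric.sphere (0 : EuclideanSpace ℝ (Fin (2 + 1))) 1)) := by
    ext x
    simp [hf_def]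
  rw [hF, singularHomology.map_comp, h0, Limits.comp_zero]

end Summit.SmoothPoincare4.SmoothPoincare4.Theorems.GromovRecognitionRelEnd.CrossCapLaurent
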